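import Summits.AtomisticToContinuum.HydrodynamicLimit.Theorems.JParityClosureLocalSecondLawContactDefs
import Mathlib.MeasureTheory.Function.L2Space

/-!
# Stub M (`stub_maxwellisation`) of the line `contact-asymmetry-information`, crux `LocalSecondLaw`
(stmt-AtomisticToContinuum-13081) — the pointwise Gibbs inequality behind `Hs(ρ̄, θ̄) ≤ h̄_kin`

The SIGN/ALGEBRA part of stub M (`contact_maxwellisation`), landed as registered sub-lemmas over the part-A vocabulary
(`c0`, `Hs`, `hsExcessFreeEnergy`, `localMaxwellian`):

* `contactM_gibbs_velocity` — **Gibbs–Jaynes velocity inequality**: a velocity density `g ≥ 0` on `ℝ³` with mass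
  `ρ = ∫ g > 0`, momentum `m = ∫ g v`, kinetic energy `e = ∫ ½|v|² g`, `g log g ∈ L¹` and positive temperature
  `θ := (2/3)(e/ρ − |m|²/(2ρ²))` has `ρ log ρ − (3/2) ρ log θ − c₀ ρ ≤ ∫ g log g`, `c₀ = (3/2)(1 + log 2π)`; the left
  side is `∫ M log M = ∫ g log M` for the moment-matched Maxwellian `M = localMaxwellian ρ θ (m/ρ)`, and the gap is
  `KL(g ‖ M) ≥ 0` (pointwise `g − M ≤ g log g − g log M`, integrated; `∫ M = ρ` by `integral_localMaxwellian`).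
* `contactM_temperature_pos` — an absolutely continuous velocity law is not a Dirac mass: with `|v|² g ∈ L¹` the
  temperature `(2/3)(e/ρ − |m|²/(2ρ²)) = (3ρ)⁻¹ ∫ |v − m/ρ|² g` is POSITIVE.
* `contactM_Hs_le_hkin` — **`Hs ≤ h_kin` pointwise, the `f_ex` terms cancel**: under the same moment hypotheses
  (finite energy instead of `θ > 0`), `Hs σ ρ θ ≤ ∫ g log g + c₀ ρ + ρ f_ex(ρσ³)`; i.e. on `{ρ̄ > 0}` the guarded
  crux entropy at the moments of a velocity law is dominated by the Résibois comparison density built from the SAME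
  law — no equation-of-state input.

What these do NOT give: the stub itself (time-`L¹` smallness of `KL(f̄ ‖ M_f̄)` for pinned bounded tilts at all
horizons — local equilibrium at positive times for deterministic hard spheres; inputs ContactChaos stmt-13477 and
RateFloor stmt-13080, both open).

References: C. Cercignani, R. Illner, M. Pulvirenti, *The Mathematical Theory of Dilute Gases* (1994) §3.2–3.3
(Maxwellian minimises `∫ f log f` at fixed `ρ, m, e`); P. Résibois, J. Stat. Phys. 19 (1978) 593 (the RET
`H`-density `h_kin`).  Worker of lead seat prover-line-stmt-AtomisticToContinuum-13081-a5-0.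
-/

noncomputable section

open scoped BigOperators Topology Classical MeasureTheory ENNReal InnerProductSpace
open Filter Set MeasureTheory Function
open Literature.MathematicalPhysics.KineticTheory
open Literature.Analysis.FluidPDE
open Summit.AtomisticToContinuum.HydrodynamicLimit.Theorems.LocalSecondLawNegative
open Summit.AtomisticToContinuum.HydrodynamicLimit.Theorems.LocalSecondLawLedger

namespace Summit.AtomisticToContinuum.HydrodynamicLimit.Theorems.LocalSecondLawContact

/-! ### Pointwise facts -/

/-- **Pointwise Gibbs inequality** `x − y ≤ x log x − x log y` for `x ≥ 0 < y` (from `log t ≤ t − 1` at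
`t = y/x`; the case `x = 0` is `−y ≤ 0`). [folklore] -/
theorem contactM_sub_le_mul_log_sub {x y : ℝ} (hx : 0 ≤ x) (hy : 0 < y) :
    x - y ≤ x * Real.log x - x * Real.log y := by
  rcases hx.eq_or_lt with h | hx'
  · rw [← h]; simp [hy.le]
  · have h := Real.log_le_sub_one_of_pos (div_pos hy hx')
    rw [Real.log_div hy.ne' hx'.ne'] at h
    have h2 : x * (Real.log y - Real.log x) ≤ x * (y / x - 1) := mul_le_mul_of_nonneg_left h hx'.le
    have h3 : x * (y / x - 1) = y - x := by field_simp
    nlinarith [h2, h3]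

/-- Logarithm of the local Maxwellian on `ℝ³`:
`log M_{ρ,u,θ}(v) = log ρ − (3/2) log 2π − (3/2) log θ − |v − u|²/(2θ)` (`ρ, θ > 0`). [folklore] -/
theorem contactM_log_localMaxwellian {ρ θ : ℝ} (hρ : 0 < ρ) (hθ : 0 < θ) (u v : V3) :
    Real.log (localMaxwellian ρ θ u v) =
      Real.log ρ - 3 / 2 * Real.log (2 * Real.pi) - 3 / 2 * Real.log θ - ‖v - u‖ ^ 2 / (2 * θ) := by
  unfold localMaxwellian
  have h2 : (0 : ℝ) < 2 * Real.pi * θ := by positivity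
  rw [Real.log_mul (mul_pos hρ (Real.rpow_pos_of_pos h2 _)).ne' (Real.exp_pos _).ne',
    Real.log_mul hρ.ne' (Real.rpow_pos_of_pos h2 _).ne', Real.log_exp, Real.log_rpow h2,
    finrank_euclideanSpace_fin, Real.log_mul (by positivity) hθ.ne']
  push_cast
  ring

/-! ### Integrability bookkeeping for a velocity law with finite mass and energy -/

/-- A function with non-zero Bochner integral is integrable (junk value `0` otherwise). [folklore] -/
theorem contactM_integrable_of_integral_pos {g : V3 → ℝ} {ρ : ℝ} (hgρ : ∫ v, g v = ρ) (hρ : 0 < ρ) :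
    Integrable g := by
  by_contra h
  rw [integral_undef h] at hgρ
  exact hρ.ne' hgρ.symm

/-- Finite mass and finite energy give a finite first moment: `|g v • v| = g|v| ≤ g + ½|v|² g`. [folklore] -/
theorem contactM_integrable_smul {g : V3 → ℝ} (hg0 : ∀ v, 0 ≤ g v) (hgi : Integrable g)
    (h2i : Integrable (fun v => ‖v‖ ^ 2 / 2 * g v)) : Integrable (fun v => g v • v) := by
  refine Integrable.mono' (hgi.add h2i) (hgi.aestronglyMeasurable.smul aestronglyMeasurable_id) ?_
  refine Eventually.of_forall fun v => ?_
  rw [norm_smul, Real.norm_eq_abs, abs_of_nonneg (hg0 v)]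
  simp only [Pi.add_apply]
  nlinarith [hg0 v, mul_nonneg (hg0 v) (sq_nonneg (‖v‖ - 1))]

/-! ### The Gibbs–Jaynes velocity inequality -/

/-- **Gibbs–Jaynes velocity inequality** (registered sub-lemma `contactM_gibbs_velocity` of stub M): for a velocity
density `g ≥ 0` on `ℝ³` with `∫ g = ρ > 0`, `∫ g v = m`, `∫ ½|v|² g = e`, `g log g ∈ L¹` and positive temperature
`θ = (2/3)(e/ρ − |m|²/(2ρ²))`, the kinetic entropy is at least the Maxwellian one:
`ρ log ρ − (3/2)ρ log θ − c₀ρ ≤ ∫ g log g` (`= ∫ M log M` for the moment-matched Maxwellian; equality iff `g = M`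
a.e.).  Proof: integrate the pointwise Gibbs inequality `g − M ≤ g log g − g log M`, `∫ M = ρ`, and compute
`∫ g log M` from the three moments. [cite: CIP1994, §3.2] -/
theorem contactM_gibbs_velocity : ∀ (g : V3 → ℝ) (ρ e : ℝ) (m : V3), (∀ v, 0 ≤ g v) → ∫ v, g v = ρ → ∫ v, g v • v = m → ∫ v, ‖v‖ ^ 2 / 2 * g v = e → Integrable (fun v => g v * Real.log (g v)) → 0 < ρ → 0 < 2 / 3 * (e / ρ - ‖m‖ ^ 2 / (2 * ρ ^ 2)) → ρ * Real.log ρ - 3 / 2 * ρ * Real.log (2 / 3 * (e / ρ - ‖m‖ ^ 2 / (2 * ρ ^ 2))) - c0 * ρ ≤ ∫ v, g v * Real.log (g v) := by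
  intro g ρ e m hg0 hgρ hgm hge hglog hρ hθ
  set θ := 2 / 3 * (e / ρ - ‖m‖ ^ 2 / (2 * ρ ^ 2)) with hθdef
  have hgi : Integrable g := contactM_integrable_of_integral_pos hgρ hρ
  -- finite energy is forced by `θ > 0` (junk `e = 0` would make `θ ≤ 0`)
  have h2i : Integrable (fun v => ‖v‖ ^ 2 / 2 * g v) := by
    by_contra h
    rw [integral_undef h] at hge
    have h1 : 0 ≤ ‖m‖ ^ 2 / (2 * ρ ^ 2) := by positivity
    have h2 : θ ≤ 0 := by
      rw [hθdef, ← hge, zero_div]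
      linarith
    exact absurd hθ (not_lt.2 h2)
  have h1i : Integrable (fun v => g v • v) := contactM_integrable_smul hg0 hgi h2i
  obtain ⟨u, hudef⟩ : ∃ u : V3, u = ρ⁻¹ • m := ⟨_, rfl⟩
  have hMi : Integrable (localMaxwellian ρ θ u) := by
    by_contra h
    have h1 := integral_localMaxwellian hθ ρ u
    rw [integral_undef h] at h1
    exact hρ.ne h1
  -- the affine-in-moments lower integrand `g log M + g − M`
  obtain ⟨c1, hc1⟩ : ∃ c1 : ℝ,
      c1 = Real.log ρ - 3 / 2 * Real.log (2 * Real.pi) - 3 / 2 * Real.log θ - ‖u‖ ^ 2 / (2 * θ) := ⟨_, rfl⟩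
  have hlogM : ∀ v, g v * Real.log (localMaxwellian ρ θ u v) =
      c1 * g v - θ⁻¹ * (‖v‖ ^ 2 / 2 * g v) + θ⁻¹ * ⟪u, g v • v⟫_ℝ := by
    intro v
    rw [contactM_log_localMaxwellian hρ hθ, norm_sub_sq_real, real_inner_smul_right, real_inner_comm u v, hc1]
    field_simp
    ring
  have hpt : ∀ v, c1 * g v - θ⁻¹ * (‖v‖ ^ 2 / 2 * g v) + θ⁻¹ * ⟪u, g v • v⟫_ℝ + g v - localMaxwellian ρ θ u v ≤
      g v * Real.log (g v) := by
    intro v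
    have h := contactM_sub_le_mul_log_sub (hg0 v) (localMaxwellian_pos hρ hθ u v)
    rw [← hlogM v]
    linarith
  have hI1 : Integrable (fun v => c1 * g v) := hgi.const_mul c1
  have hI2 : Integrable (fun v => θ⁻¹ * (‖v‖ ^ 2 / 2 * g v)) := h2i.const_mul _
  have hI3 : Integrable (fun v => θ⁻¹ * ⟪u, g v • v⟫_ℝ) := (h1i.const_inner u).const_mul _
  have hI12 : Integrable (fun v => c1 * g v - θ⁻¹ * (‖v‖ ^ 2 / 2 * g v)) := hI1.sub hI2
  have hI123 : Integrable (fun v => c1 * g v - θ⁻¹ * (‖v‖ ^ 2 / 2 * g v) + θ⁻¹ * ⟪u, g v • v⟫_ℝ) :=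
    hI12.add hI3
  have hI1234 : Integrable (fun v => c1 * g v - θ⁻¹ * (‖v‖ ^ 2 / 2 * g v) + θ⁻¹ * ⟪u, g v • v⟫_ℝ + g v) :=
    hI123.add hgi
  have hFi : Integrable (fun v => c1 * g v - θ⁻¹ * (‖v‖ ^ 2 / 2 * g v) + θ⁻¹ * ⟪u, g v • v⟫_ℝ + g v -
      localMaxwellian ρ θ u v) := hI1234.sub hMi
  have hint : ∫ v, (c1 * g v - θ⁻¹ * (‖v‖ ^ 2 / 2 * g v) + θ⁻¹ * ⟪u, g v • v⟫_ℝ + g v -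
      localMaxwellian ρ θ u v) = c1 * ρ - θ⁻¹ * e + θ⁻¹ * ⟪u, m⟫_ℝ + ρ - ρ := by
    rw [integral_sub hI1234 hMi, integral_add hI123 hgi, integral_add hI12 hI3, integral_sub hI1 hI2,
      integral_const_mul, integral_const_mul, integral_const_mul, integral_inner h1i, hgρ, hge, hgm,
      integral_localMaxwellian hθ ρ u]
  -- evaluate the moments of `log M` at `u = m/ρ`
  have hu2 : ‖u‖ ^ 2 = ρ⁻¹ ^ 2 * ‖m‖ ^ 2 := by
    rw [hudef, norm_smul, Real.norm_eq_abs, abs_of_pos (inv_pos.2 hρ), mul_pow]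
  have hum : ⟪u, m⟫_ℝ = ρ⁻¹ * ‖m‖ ^ 2 := by
    rw [hudef, real_inner_smul_left, real_inner_self_eq_norm_sq]
  have he : e = 3 / 2 * ρ * θ + ‖m‖ ^ 2 / (2 * ρ) := by
    rw [hθdef]
    field_simp
    ring
  have hval : c1 * ρ - θ⁻¹ * e + θ⁻¹ * ⟪u, m⟫_ℝ + ρ - ρ = ρ * Real.log ρ - 3 / 2 * ρ * Real.log θ - c0 * ρ := by
    rw [hc1, hu2, hum, he, c0]
    field_simp
    ring
  calc ρ * Real.log ρ - 3 / 2 * ρ * Real.log θ - c0 * ρ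
      = ∫ v, (c1 * g v - θ⁻¹ * (‖v‖ ^ 2 / 2 * g v) + θ⁻¹ * ⟪u, g v • v⟫_ℝ + g v -
          localMaxwellian ρ θ u v) := by rw [hint, hval]
    _ ≤ ∫ v, g v * Real.log (g v) := integral_mono hFi hglog fun v => hpt v

/-! ### Positivity of the temperature of a velocity law -/

/-- **An absolutely continuous velocity law has positive temperature** (registered sub-lemma
`contactM_temperature_pos`): for `g ≥ 0` with `∫ g = ρ > 0`, `∫ g v = m`, `∫ ½|v|² g = e` and `|v|² g ∈ L¹`,
`0 < (2/3)(e/ρ − |m|²/(2ρ²))`, because `e/ρ − |m|²/(2ρ²) = (2ρ)⁻¹ ∫ |v − m/ρ|² g dv` and `g dv` charges the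
complement of the point `m/ρ`. [folklore] -/
theorem contactM_temperature_pos : ∀ (g : V3 → ℝ) (ρ e : ℝ) (m : V3), (∀ v, 0 ≤ g v) → ∫ v, g v = ρ → ∫ v, g v • v = m → ∫ v, ‖v‖ ^ 2 / 2 * g v = e → Integrable (fun v => ‖v‖ ^ 2 * g v) → 0 < ρ → 0 < 2 / 3 * (e / ρ - ‖m‖ ^ 2 / (2 * ρ ^ 2)) := by
  intro g ρ e m hg0 hgρ hgm hge h2 hρ
  have hgi : Integrable g := contactM_integrable_of_integral_pos hgρ hρ
  have h2i : Integrable (fun v => ‖v‖ ^ 2 / 2 * g v) :=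
    (h2.div_const 2).congr (Eventually.of_forall fun v => by simp only; ring)
  have h1i : Integrable (fun v => g v • v) := contactM_integrable_smul hg0 hgi h2i
  obtain ⟨u, hudef⟩ : ∃ u : V3, u = ρ⁻¹ • m := ⟨_, rfl⟩
  -- the centred second moment, expanded
  have hexp : ∀ v, ‖v - u‖ ^ 2 * g v = 2 * (‖v‖ ^ 2 / 2 * g v) - 2 * ⟪u, g v • v⟫_ℝ + ‖u‖ ^ 2 * g v := by
    intro v
    rw [norm_sub_sq_real, real_inner_smul_right, real_inner_comm u v]
    ring
  have hJ1 : Integrable (fun v => 2 * (‖v‖ ^ 2 / 2 * g v)) := h2i.const_mul 2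
  have hJ2 : Integrable (fun v => 2 * ⟪u, g v • v⟫_ℝ) := (h1i.const_inner u).const_mul 2
  have hJ3 : Integrable (fun v => ‖u‖ ^ 2 * g v) := hgi.const_mul _
  have hJ12 : Integrable (fun v => 2 * (‖v‖ ^ 2 / 2 * g v) - 2 * ⟪u, g v • v⟫_ℝ) := hJ1.sub hJ2
  have hfun : (fun v => ‖v - u‖ ^ 2 * g v) =
      fun v => 2 * (‖v‖ ^ 2 / 2 * g v) - 2 * ⟪u, g v • v⟫_ℝ + ‖u‖ ^ 2 * g v := funext hexp
  have hci : Integrable (fun v => ‖v - u‖ ^ 2 * g v) := by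
    rw [hfun]
    exact hJ12.add hJ3
  have hcint : ∫ v, ‖v - u‖ ^ 2 * g v = 2 * e - 2 * ⟪u, m⟫_ℝ + ‖u‖ ^ 2 * ρ := by
    rw [hfun, integral_add hJ12 hJ3, integral_sub hJ1 hJ2, integral_const_mul, integral_const_mul,
      integral_const_mul, integral_inner h1i, hge, hgm, hgρ]
  -- `g dv` is not carried by the point `u`
  have hsupp : 0 < volume (support g) :=
    (integral_pos_iff_support_of_nonneg (fun v => hg0 v) hgi).1 (hgρ ▸ hρ)
  have hpos : 0 < ∫ v, ‖v - u‖ ^ 2 * g v := by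
    rw [integral_pos_iff_support_of_nonneg (fun v => mul_nonneg (sq_nonneg _) (hg0 v)) hci]
    have hs : support (fun v => ‖v - u‖ ^ 2 * g v) = support g \ {u} := by
      ext v
      simp only [mem_support, ne_eq, mul_eq_zero, not_or, Set.mem_sdiff, mem_singleton_iff, pow_eq_zero_iff,
        OfNat.ofNat_ne_zero, not_false_eq_true, norm_eq_zero, sub_eq_zero]
      exact and_comm
    rw [hs, measure_sdiff_null (measure_singleton u)]
    exact hsupp
  have hu2 : ‖u‖ ^ 2 = ρ⁻¹ ^ 2 * ‖m‖ ^ 2 := by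
    rw [hudef, norm_smul, Real.norm_eq_abs, abs_of_pos (inv_pos.2 hρ), mul_pow]
  have hum : ⟪u, m⟫_ℝ = ρ⁻¹ * ‖m‖ ^ 2 := by
    rw [hudef, real_inner_smul_left, real_inner_self_eq_norm_sq]
  have hid : 2 / 3 * (e / ρ - ‖m‖ ^ 2 / (2 * ρ ^ 2)) = (3 * ρ)⁻¹ * ∫ v, ‖v - u‖ ^ 2 * g v := by
    rw [hcint, hu2, hum]
    field_simp
    ring
  rw [hid]
  exact mul_pos (by positivity) hpos

/-! ### `Hs ≤ h_kin` pointwise: the excess free energy cancels -/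

/-- **`Hs(ρ, θ) ≤ h_kin` at the moments of a velocity law** (registered sub-lemma `contactM_Hs_le_hkin` of stub M;
"the `f_ex` terms CANCEL"): for `g ≥ 0` on `ℝ³` with `∫ g = ρ > 0`, `∫ g v = m`, `∫ ½|v|² g = e`, `|v|² g ∈ L¹` and
`g log g ∈ L¹`, the guarded crux entropy at `(ρ, θ)`, `θ = (2/3)(e/ρ − |m|²/(2ρ²))` (the `thetaBar`/`thetaC`
formula), is at most the Résibois comparison density `∫ g log g + c₀ρ + ρ f_ex(ρσ³)` of the SAME law: the guard is
off (`θ > 0` by `contactM_temperature_pos`), `Hs = ρ log ρ − (3/2)ρ log θ + ρ f_ex(ρσ³)`, and the velocity part is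
`contactM_gibbs_velocity`.  This is the pointwise sign `Hs(ρ̄, θ̄) − h̄_kin ≤ 0` on `{ρ̄ > 0}` behind
`maxwellGapEns`, before the Jensen step in `x`. [cite: CIP1994, §3.2] -/
theorem contactM_Hs_le_hkin : ∀ (σ : ℝ) (g : V3 → ℝ) (ρ e : ℝ) (m : V3), (∀ v, 0 ≤ g v) → ∫ v, g v = ρ → ∫ v, g v • v = m → ∫ v, ‖v‖ ^ 2 / 2 * g v = e → Integrable (fun v => ‖v‖ ^ 2 * g v) → Integrable (fun v => g v * Real.log (g v)) → 0 < ρ → Hs σ ρ (2 / 3 * (e / ρ - ‖m‖ ^ 2 / (2 * ρ ^ 2))) ≤ (∫ v, g v * Real.log (g v)) + c0 * ρ + ρ * hsExcessFreeEnergy (ρ * σ ^ 3) := by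
  intro σ g ρ e m hg0 hgρ hgm hge h2 hglog hρ
  have hθ : 0 < 2 / 3 * (e / ρ - ‖m‖ ^ 2 / (2 * ρ ^ 2)) := contactM_temperature_pos g ρ e m hg0 hgρ hgm hge h2 hρ
  have hG := contactM_gibbs_velocity g ρ e m hg0 hgρ hgm hge hglog hρ hθ
  unfold Hs
  rw [if_pos ⟨hρ, hθ⟩]
  linarith

end Summit.AtomisticToContinuum.HydrodynamicLimit.Theorems.LocalSecondLawContact

end
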